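import Summits.BirchSwinnertonDyer.Rank1Residual.X1.GeneratorBoundMuLayer
import Summits.BirchSwinnertonDyer.Rank1Residual.Additive.ZpTowerSelmerInfty
import Summits.BirchSwinnertonDyer.Rank1Residual.Additive.BudgetFromTamagawaWitnesses
import Summits.BirchSwinnertonDyer.Rank1Residual.Additive.LayerNoPTorsion
import HarnessLib

/-!
# Route M's generator COUNT at LAYER `n`, II: the restricted-tower transport is `Γ`-EQUIVARIANT,
# so level-0 classes over `K_n` land in `Sel_{p^∞}(E/K_∞)[p]^{Γ_n}` and are counted by
# `X/(p, ω_n)X` — route T's `t_n ≤ λ + pⁿ μ` at every member (cell `b2b-bsdres`, unit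
# `b2b-bsdres-eisenstein-p1`, gen 17; X1R0-GAPMAP §25.7 V76 (ii), §26.4 (a))

HONEST FRAMING (run/shared/lean/b2b/bsd-rank1-residual/, verbatim in every file): the goal of the
cell is to DELETE the COMBINATION-SHAPED residual classes of the Birch–Swinnerton-Dyer formula for
ALL analytic-rank `≤ 1` elliptic curves over `ℚ` — "full BSD formula for every rank `≤ 1` curve in
class `C`" assembled STRICTLY from published theorems — so that the rank-`≤ 1` remainder becomes
exactly the CONSTRUCTION-SHAPED classes, which are TYPED (missing-input `Prop`s), NOT attempted.
This is not "finishing BSD". Sub-cell `b2b-bsdres-eisenstein-p1` (CLASS-OWNERS row "X1 (r = 0)"):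
research route; NO CLAIM BEYOND STATED CLASSES; nothing here changes a label; nothing is booked.
THEOREMS ONLY — no definition, no named fact, no typed input introduced, nothing about any
particular curve asserted.

## What and why

n1011's restricted tower (`Additive/ZpTowerSeam`, `ZpTower.exists_restrictTower`: a `ℤ_p`-extension
`κ_n` of the layer `K_n` with `κ_n·pⁿ = κ ∘ resGal`) and transport
`kerH1Iso : H¹(ker κ_n, E_{K_n}[p^∞]) ≃+ H¹(ker κ, E[p^∞])` (`Additive/ZpTowerKernelH1`,
`Additive/ZpTowerSelmerInfty`: it carries `Sel_{p^∞}(E_{K_n}/K_{n,∞})` into `Sel_{p^∞}(E/K_∞)`)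
feed the Route-G budget at level `n` — but as an ABSTRACT injective homomorphism, so the
transported classes forget that they came from `H¹(K_n, ·)`. Gen 17 FILES 4–5
(`X1/GeneratorCountLayer`, `X1/GeneratorBoundMuLayer`) count classes of `Sel_{p^∞}(E/K_∞)[p]` FIXED
BY `γ^{pⁿ}` by `#(X/(p, ω_n)X) ≤ p^{λ + pⁿμ}`. THIS FILE supplies the missing invariance:

* §1 **`kerH1Iso_conjH1`: `kerH1Iso (conj_σ' x) = conj_{resGal σ'} (kerH1Iso x)`** for
  `σ' ∈ Γ_{K_n}` — both sides are maps of compatible pairs (`resH1Hom_comp`), and the pairs agree: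
  `kerOfKer (σ⁻¹τσ) = σ'⁻¹ (kerOfKer τ) σ'` (`resGal` injective) and
  `pBCE⁻¹(σ'·Q) = (resGal σ')·pBCE⁻¹(Q)` (`primaryBaseChangeEquiv_symm_smul`).
* §2 `conjH1_kerH1Iso_eq_of_mem_layerSubgroup`: hence the transport of a class restricted from
  `H¹(K_n, E[p^∞])` (`im h'_0`, fixed by `Γ_{K_n}`: tree `range_layerToInfty_le_layerInvariants_holds`)
  is fixed by `conj_g` for every `g ∈ Gal(K̄/K_n) = κ⁻¹(pⁿℤ_p)` (`galRange K_n = κ.layerSubgroup n`,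
  the seam), in particular by `γ^{pⁿ}`.
* §3 **`card_le_natCard_quotient_layerIdeal_of_restrictTower`: a finite family of DISTINCT
  `p`-torsion classes of `A'_0 = h'_0⁻¹(Sel_{p^∞}(E_{K_n}/K_{n,∞})) ⊆ H¹(K_n, E[p^∞])` has at most
  `#(X/I_n X)` members**, `I_n = (p, (1+T)^{pⁿ} − 1)`, for EVERY dual datum `D` of `Sel_{p^∞}(E/K_∞)`
  over `(κ, γ)` with `X = D.X` finitely generated, when `E(K)[p] = 0` (then `E(K_n)[p] = 0`, n1011's
  `forall_smul_eq_zero_baseChange_layer`); `…_le_pow`: `≤ p^{λ(X) + pⁿ μ(X)}` when `X` is torsion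
  without nonzero finite submodules.
* §4 **`pow_card_le_natCard_quotient_layerIdeal_of_tamagawaWitnesses_layer`**: with n1011's K-general
  level-0 socket over `K_n` (`exists_finset_layerZero_of_tamagawaWitnesses`: Poitou–Tate family,
  local Euler–Poincaré, `p` odd, `#T₀` Tamagawa witnesses at places `w ∤ p` of `K_n`):
  `p^{#T₀} ≤ #(X/I_n X)`, hence **`#T₀ ≤ λ(X) + pⁿ μ(X)`** — route T's layer-`n` Tamagawa bound
  (X1R0-GAPMAP §14.1, `t_n ≤ λ + pⁿμ − a + 2δ` without the local term) at a member of ANY `μ`, where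
  n1011's `budgetLeLambdaAt_layer_…` needed `μ = 0`.

NOT here: the local term `a` at the prime of `K_n` above `p` and the `δ = 1` loss over `K_n`; the
census certificates over `ℚ` (n1011's `TamagawaWitnessesLayer` / `BudgetFromTamagawaCertificatesLayer*`
produce the `hwit` of §4 from the three census columns). Nothing is booked by this file.

References: [SerreGaloisCohomology1997] I.§2.4–2.5, II.§1.1; [GreenbergLNM1716] §1 p. 60, §3
pp. 85–86, §5 pp. 114–118, p. 137; [Washington1997] §13.1–13.2; X1R0-GAPMAP §14.1, §25.7, §26.
-/

noncomputable section

open scoped Classical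

open Function Field NumberField IsDedekindDomain WeierstrassCurve PowerSeries
  Literature.NumberTheory.EllipticCurves Literature.NumberTheory.GaloisRepresentations
  Literature.NumberTheory.GaloisCohomology
  Literature.NumberTheory.EllipticCurves.IwasawaAlgebra IsLocalRing
  Summit.BirchSwinnertonDyer.Rank1Residual.Additive
  Summit.BirchSwinnertonDyer.Rank1Residual.Additive.ZpTower
  Summit.BirchSwinnertonDyer.Rank1Residual.X1.GeneratorCountLayer
  Summit.BirchSwinnertonDyer.Rank1Residual.X1.GeneratorBoundMuLayer
open Literature.NumberTheory.GaloisRepresentations.DiscreteGaloisModule (unramifiedSubgroup)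

set_option autoImplicit false

namespace Summit.BirchSwinnertonDyer.Rank1Residual.X1.GeneratorCountLayerTransport

-- `K : Type` (universe 0): n1011's level-0 socket `exists_finset_layerZero_of_tamagawaWitnesses` is
-- stated in universe 0; the layer `κ.layer n` of a `K : Type` is again in `Type`.
variable {K : Type} [Field K] [NumberField K] {p : ℕ} [hp : Fact p.Prime]
variable (W : WeierstrassCurve K) (κ : ZpExtension K p) (n : ℕ) (κn : ZpExtension (κ.layer n) p)
  (hκn : ∀ σ : Field.absoluteGaloisGroup (κ.layer n),
    (κn σ).toAdd * (p : ℤ_[p]) ^ n = (κ (resGal (K := K) (κ.layer n) σ)).toAdd)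

/-! ## §1. The transport `kerH1Iso` is `Γ`-equivariant -/

/-- The group halves of the two pairs agree: `kerOfKer (σ⁻¹ τ σ) = σ'⁻¹ (kerOfKer τ) σ'` for
`σ = resGal σ'` (`resGal` is injective and `resGal (kerOfKer τ) = τ`). [cite: SerreGaloisCohomology1997, II.§1.1] -/
theorem subgroupConj_comp_kerOfKer (σ' : Field.absoluteGaloisGroup (κ.layer n)) :
    (subgroupConj κn.kerSubgroup σ').comp (kerOfKer κ n κn hκn) =
      (kerOfKer κ n κn hκn).comp (subgroupConj κ.kerSubgroup (resGal (K := K) (κ.layer n) σ')) := by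
  refine ContinuousMonoidHom.ext fun τ ↦ Subtype.ext (resGal_injective (K := K) (κ.layer n) ?_)
  change resGal (K := K) (κ.layer n) ((subgroupConj κn.kerSubgroup σ') (kerOfKer κ n κn hκn τ) :
      Field.absoluteGaloisGroup (κ.layer n)) =
    resGal (K := K) (κ.layer n) (kerOfKer κ n κn hκn
      (subgroupConj κ.kerSubgroup (resGal (K := K) (κ.layer n) σ') τ) : κn.kerSubgroup)
  rw [resGal_kerOfKer, subgroupConj_apply_coe, subgroupConj_apply_coe, map_mul, map_mul, map_inv,
    resGal_kerOfKer]

/-- The coefficient halves agree: `pBCE⁻¹(σ'·Q) = (resGal σ')·pBCE⁻¹(Q)`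
(`primaryBaseChangeEquiv_symm_smul` at `resGalToRange σ'`). [cite: SerreGaloisCohomology1997, II.§1.1] -/
theorem primaryBaseChangeEquiv_symm_smul_gal (σ' : Field.absoluteGaloisGroup (κ.layer n))
    (Q : geomPrimaryTorsion (W.baseChange (κ.layer n)) p) :
    (primaryBaseChangeEquiv (κ.layer n) W p).symm (σ' • Q) =
      resGal (K := K) (κ.layer n) σ' • (primaryBaseChangeEquiv (κ.layer n) W p).symm Q := by
  have h := primaryBaseChangeEquiv_symm_smul (κ.layer n) W p (resGalToRange (K := K) (κ.layer n) σ') Q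
  rw [rangeToResGal_resGalToRange, Subgroup.smul_def] at h
  exact h

/-- **`kerH1Iso` is `Γ`-equivariant: `kerH1Iso (conj_{σ'} x) = conj_{resGal σ'} (kerH1Iso x)`** for
every `σ' ∈ Γ_{K_n}` and `x ∈ H¹(ker κ_n, E_{K_n}[p^∞])` — both sides are the maps of composite
compatible pairs (`resH1Hom_comp`), which agree (§1). [cite: SerreGaloisCohomology1997, I.§2.4–2.5, II.§1.1] -/
theorem kerH1Iso_conjH1 (σ' : Field.absoluteGaloisGroup (κ.layer n))
    (x : (W.baseChange (κ.layer n)).subgroupH1 p κn.kerSubgroup) :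
    kerH1Iso W κ n κn hκn ((W.baseChange (κ.layer n)).conjH1 p κn.kerSubgroup σ' x) =
      W.conjH1 p κ.kerSubgroup (resGal (K := K) (κ.layer n) σ') (kerH1Iso W κ n κn hκn x) := by
  rw [kerH1Iso_apply, kerH1Iso_apply, ← AddMonoidHom.comp_apply]
  conv_rhs => rw [← AddMonoidHom.comp_apply]
  simp only [WeierstrassCurve.conjH1, Literature.NumberTheory.EllipticCurves.conjH1]
  rw [resH1Hom_comp, resH1Hom_comp]
  refine DFunLike.congr_fun (resH1Hom_congr (subgroupConj_comp_kerOfKer κ n κn hκn σ') ?_ _ _) x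
  refine AddMonoidHom.ext fun Q ↦ ?_
  simp only [AddMonoidHom.coe_comp, Function.comp_apply, AddEquiv.coe_toAddMonoidHom,
    DistribSMul.toAddMonoidHom_apply]
  exact primaryBaseChangeEquiv_symm_smul_gal W κ n σ' Q

/-! ## §2. Transported level-0 classes over `K_n` are fixed by `Gal(K̄/K_n) = κ⁻¹(pⁿℤ_p)` -/

/-- **A transported class restricted from `H¹(K_n, E[p^∞])` is fixed by `conj_g`, `g ∈ κ⁻¹(pⁿℤ_p)`**:
`g = resGal σ'` (`galRange K_n = κ.layerSubgroup n`, the seam), the class `h'_0 z` is fixed by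
`conj_{σ'}` (`range_layerToInfty_le_layerInvariants_holds` for `κ_n` at layer `0`, `κ_n⁻¹(ℤ_p) = ⊤`),
and §1. [cite: GreenbergLNM1716, Thm. 1.2] [cite: Washington1997, §13.1] -/
theorem conjH1_kerH1Iso_layerToInfty_eq
    (z : (W.baseChange (κ.layer n)).subgroupH1 p (κn.layerSubgroup 0))
    {g : Field.absoluteGaloisGroup K} (hg : g ∈ κ.layerSubgroup n) :
    W.conjH1 p κ.kerSubgroup g
        (kerH1Iso W κ n κn hκn ((W.baseChange (κ.layer n)).layerToInfty κn 0 z)) =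
      kerH1Iso W κ n κn hκn ((W.baseChange (κ.layer n)).layerToInfty κn 0 z) := by
  rw [← galRange_layer_eq_layerSubgroup κ n] at hg
  obtain ⟨σ', rfl⟩ := hg
  change W.conjH1 p κ.kerSubgroup (resGal (K := K) (κ.layer n) σ') _ = _
  rw [← kerH1Iso_conjH1]
  congr 1
  have hmem := (W.baseChange (κ.layer n)).range_layerToInfty_le_layerInvariants_holds κn 0 ⟨z, rfl⟩
  rw [mem_layerInvariants_iff] at hmem
  exact hmem σ' (by rw [ZpExtension.layerSubgroup_zero]; exact Subgroup.mem_top σ')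

/-! ## §3. The count: level-0 classes over `K_n` are counted by `X/(p, ω_n)X` -/

section Count

variable {W κ} {γ : Field.absoluteGaloisGroup K} (D : W.SelmerDualData κ γ)

include hκn

/-- **`#A'_0[p]`-families over `K_n` are counted by `X/I_n X`.** For an elliptic curve `E = W` over
a number field `K` with `E(K)[p] = 0`, a `ℤ_p`-extension `κ`, a layer `n` with restricted tower
`κ_n`, any `γ ∈ Γ_K` and any Pontryagin-dual datum `D` of `Sel_{p^∞}(E/K_∞)` with `X = D.X` finitely
generated: a finite family of DISTINCT `p`-torsion classes of
`A'_0 = h'_0⁻¹(Sel_{p^∞}(E_{K_n}/K_{n,∞})) ⊆ H¹(K_n, E[p^∞])` has at most `#(X/I_n X)` members,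
`I_n = (p, (1+T)^{pⁿ} − 1)`: transport by `kerH1Iso ∘ h'_0` (injective: `E(K_n)[p] = 0`, n1011's
`forall_smul_eq_zero_baseChange_layer` + `layerToInfty_injective_of_no_pTorsion`; into `Sel_∞`:
`kerH1Iso_mem_selmerInfty`), the images are `p`-torsion and fixed by `γ^{pⁿ} ∈ κ⁻¹(pⁿℤ_p)` (§2),
and FILE 4's `card_le_natCard_quotient_layerIdeal`. [cite: GreenbergLNM1716, §1 p. 60, §3 pp. 85–86] -/
theorem card_le_natCard_quotient_layerIdeal_of_restrictTower [W.IsElliptic]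
    [Module.Finite (IwasawaAlgebra p) D.X] (hK : ∀ P : W.toAffine.Point, p • P = 0 → P = 0)
    (s : Finset {z : (W.baseChange (κ.layer n)).selmerInftyPreimage κn 0 // p • z = 0}) :
    s.card ≤ Nat.card (D.X ⧸ Ideal.span {(C (p : ℤ_[p]) : IwasawaAlgebra p),
        (1 + (X : IwasawaAlgebra p)) ^ p ^ n - 1} • (⊤ : Submodule (IwasawaAlgebra p) D.X)) := by
  have hKn := forall_smul_eq_zero_baseChange_layer W p κ hK n
  -- the transport `A'_0[p] → Sel_∞`
  let g : {z : (W.baseChange (κ.layer n)).selmerInftyPreimage κn 0 // p • z = 0} →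
      W.selmerInfty κ := fun z ↦
    ⟨kerH1Iso W κ n κn hκn ((W.baseChange (κ.layer n)).layerToInfty κn 0
        (z.1 : (W.baseChange (κ.layer n)).subgroupH1 p (κn.layerSubgroup 0))),
      kerH1Iso_mem_selmerInfty W κ n κn hκn _ z.1.2⟩
  have hg_coe : ∀ z, ((g z : W.selmerInfty κ) : W.subgroupH1 p κ.kerSubgroup) =
      kerH1Iso W κ n κn hκn ((W.baseChange (κ.layer n)).layerToInfty κn 0
        (z.1 : (W.baseChange (κ.layer n)).subgroupH1 p (κn.layerSubgroup 0))) := fun _ ↦ rfl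
  have hg : Function.Injective g := by
    intro z z' h
    have h' := congrArg (fun s : W.selmerInfty κ ↦ (s : W.subgroupH1 p κ.kerSubgroup)) h
    simp only [hg_coe] at h'
    exact Subtype.ext (Subtype.ext (Additive.layerToInfty_injective_of_no_pTorsion
      (W.baseChange (κ.layer n)) κn (fun Q hQ ↦ hKn Q (by convert hQ)) 0
      ((kerH1Iso W κ n κn hκn).injective h')))
  rw [← Finset.card_map ⟨g, hg⟩]
  refine card_le_natCard_quotient_layerIdeal D n _ fun t ht ↦ ?_
  obtain ⟨z, -, rfl⟩ := Finset.mem_map.mp ht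
  refine ⟨?_, ?_⟩
  · -- `p`-torsion
    apply Subtype.ext
    have hz : ((p • z.1 : (W.baseChange (κ.layer n)).selmerInftyPreimage κn 0) :
        (W.baseChange (κ.layer n)).subgroupH1 p (κn.layerSubgroup 0)) = 0 := by
      rw [z.2]; rfl
    change p • kerH1Iso W κ n κn hκn ((W.baseChange (κ.layer n)).layerToInfty κn 0
      (z.1 : (W.baseChange (κ.layer n)).subgroupH1 p (κn.layerSubgroup 0))) = 0
    rw [← map_nsmul, ← map_nsmul, ← AddSubgroup.coe_nsmul, hz, map_zero, map_zero]
  · -- fixed by `γ^{pⁿ}`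
    exact conjH1_kerH1Iso_layerToInfty_eq W κ n κn hκn _ (pow_mem_layerSubgroup κ γ n)

/-- **… hence at most `p^{λ(X) + pⁿ μ(X)}` members** when `X` is torsion without nonzero finite
`Λ`-submodules (FILE 5 `natCard_quotient_layerIdeal_le_pow`). [cite: GreenbergLNM1716, §1 p. 60, p. 137] -/
theorem card_le_pow_of_restrictTower [W.IsElliptic] [Module.Finite (IwasawaAlgebra p) D.X]
    (hX : D.IsTorsion) (hnf : ∀ N : Submodule (IwasawaAlgebra p) D.X, Finite N → N = ⊥)
    (hK : ∀ P : W.toAffine.Point, p • P = 0 → P = 0)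
    (s : Finset {z : (W.baseChange (κ.layer n)).selmerInftyPreimage κn 0 // p • z = 0}) :
    s.card ≤ p ^ (lambdaInvariant p D.X + p ^ n * muInvariant p D.X) :=
  (card_le_natCard_quotient_layerIdeal_of_restrictTower n κn hκn D hK s).trans
    (natCard_quotient_layerIdeal_le_pow D.X hX hnf n)

end Count

/-! ## §4. Route T's layer-`n` Tamagawa bound at a member of ANY `μ`: `#T₀ ≤ λ + pⁿ μ` -/

section Tamagawa

variable {W κ} {γ : Field.absoluteGaloisGroup K} (D : W.SelmerDualData κ γ)

include hκn

/-- **`p^{#T₀} ≤ #(X/I_n X)` from `#T₀` Tamagawa witnesses over `K_n`**: n1011's K-general level-0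
socket `exists_finset_layerZero_of_tamagawaWitnesses` over the layer `K_n = κ.layer n` with its
restricted tower `κ_n` (cyclotomic when `κ` is, `isCyclotomic_restrictTower`) — `p` odd,
`E(K)[p] = 0`, a Poitou–Tate family over `K_n` (`inv`, perfect, sum of local terms zero, Selmer
complement), the local Euler–Poincaré formula at the places of `K_n`, and `T₀` places `w ∤ p` of
`K_n` each with a witness `u ∈ H¹_ur((K_n)_w, E[p]) ∖ 𝓚_w` — gives `p^{#T₀}` classes of `A'_0[p]`,
counted by §3. [cite: GreenbergLNM1716, §5 pp. 114–118, p. 137] -/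
theorem pow_card_le_natCard_quotient_layerIdeal_of_tamagawaWitnesses_layer [W.IsElliptic]
    [Module.Finite (IwasawaAlgebra p) D.X] [NumberField (κ.layer n)] (hodd : p ≠ 2)
    (hK : ∀ P : W.toAffine.Point, p • P = 0 → P = 0) (hκ : κ.IsCyclotomic)
    (inv : LocalInvariants (κ.layer n) p) (hperf : inv.IsPerfect) (hsum : inv.SumLocalTermEqZero)
    (hcompl : inv.SelmerComplement)
    (hEP : ∀ w : HeightOneSpectrum (𝓞 (κ.layer n)),
      localEulerPoincareCharacteristic (w.adicCompletion (κ.layer n)))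
    (T₀ : Finset (HeightOneSpectrum (𝓞 (κ.layer n))))
    (hT₀p : ∀ w ∈ T₀, ((p : ℕ) : 𝓞 (κ.layer n)) ∉ w.asIdeal)
    (hwit : ∀ w ∈ T₀, ∃ u ∈ unramifiedSubgroup
        (((W.baseChange (κ.layer n)).torsionGaloisModule (p : ℤ)).restrictField
          (w.adicCompletion (κ.layer n))) 1,
      u ∉ (W.baseChange (κ.layer n)).kummerLocalConditionAt (p : ℤ) (w.adicCompletion (κ.layer n))) :
    p ^ T₀.card ≤ Nat.card (D.X ⧸ Ideal.span {(C (p : ℤ_[p]) : IwasawaAlgebra p),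
        (1 + (X : IwasawaAlgebra p)) ^ p ^ n - 1} • (⊤ : Submodule (IwasawaAlgebra p) D.X)) := by
  have hKn : ∀ Q : (W.baseChange (κ.layer n)).toAffine.Point, p • Q = 0 → Q = 0 :=
    forall_smul_eq_zero_baseChange_layer W p κ hK n
  have hκnc : κn.IsCyclotomic := ZpTower.isCyclotomic_restrictTower κ n κn hκn hκ
  obtain ⟨s, hs⟩ := exists_finset_layerZero_of_tamagawaWitnesses (W.baseChange (κ.layer n)) p hodd
    (fun Q hQ ↦ hKn Q (by convert hQ)) inv hperf hsum hcompl hEP T₀ hT₀p hwit κn hκnc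
  exact hs.trans (card_le_natCard_quotient_layerIdeal_of_restrictTower n κn hκn D hK s)

/-- **ROUTE T at layer `n`, Tamagawa part, ANY `μ`: `#T₀ ≤ λ(X) + pⁿ μ(X)`** for every dual datum of
`Sel_{p^∞}(E/K_∞)` with `X` torsion and without nonzero finite submodules, under the hypotheses of
the previous theorem (X1R0-GAPMAP §14.1's `t_n ≤ λ + pⁿμ` without the local term `a` and the
`δ`-loss; n1011's `budgetLeLambdaAt_layer_…` is the case `μ = 0`).
[cite: GreenbergLNM1716, §5 pp. 114–118 (proof of Cor. 5.6), p. 137] -/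
theorem card_le_lambda_add_pow_mul_mu_of_tamagawaWitnesses_layer [W.IsElliptic]
    [Module.Finite (IwasawaAlgebra p) D.X] [NumberField (κ.layer n)] (hodd : p ≠ 2)
    (hX : D.IsTorsion) (hnf : ∀ N : Submodule (IwasawaAlgebra p) D.X, Finite N → N = ⊥)
    (hK : ∀ P : W.toAffine.Point, p • P = 0 → P = 0) (hκ : κ.IsCyclotomic)
    (inv : LocalInvariants (κ.layer n) p) (hperf : inv.IsPerfect) (hsum : inv.SumLocalTermEqZero)
    (hcompl : inv.SelmerComplement)
    (hEP : ∀ w : HeightOneSpectrum (𝓞 (κ.layer n)),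
      localEulerPoincareCharacteristic (w.adicCompletion (κ.layer n)))
    (T₀ : Finset (HeightOneSpectrum (𝓞 (κ.layer n))))
    (hT₀p : ∀ w ∈ T₀, ((p : ℕ) : 𝓞 (κ.layer n)) ∉ w.asIdeal)
    (hwit : ∀ w ∈ T₀, ∃ u ∈ unramifiedSubgroup
        (((W.baseChange (κ.layer n)).torsionGaloisModule (p : ℤ)).restrictField
          (w.adicCompletion (κ.layer n))) 1,
      u ∉ (W.baseChange (κ.layer n)).kummerLocalConditionAt (p : ℤ) (w.adicCompletion (κ.layer n))) :
    T₀.card ≤ lambdaInvariant p D.X + p ^ n * muInvariant p D.X :=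
  (Nat.pow_le_pow_iff_right (Nat.Prime.one_lt hp.out)).mp
    ((pow_card_le_natCard_quotient_layerIdeal_of_tamagawaWitnesses_layer n κn hκn D hodd hK hκ inv
      hperf hsum hcompl hEP T₀ hT₀p hwit).trans (natCard_quotient_layerIdeal_le_pow D.X hX hnf n))

end Tamagawa

end Summit.BirchSwinnertonDyer.Rank1Residual.X1.GeneratorCountLayerTransport

end
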